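import Literature.MathematicalPhysics.QuantumFieldTheory.Balaban1983to89.B4SubBoxCarrier

/-!
# `Balaban1983to89.B4CubeGreenBox` — [Balaban1983RegularityDecay] §2 pp. 575–576: ON A BOX `Ω`, THE CUBE PROPAGATOR
# `G_k(□_j, Ã_j)` OF THE PARAMETRIX (2.2) IS THE LINEAGE's `greenA` ON THE SUB-BOX — the hypothesis `hGj` of the walk
# route (`B4Ineq110WalkRoute.ineq110_value`) DISCHARGED for every cube field `Ã`, and its inputs `γ` (‖G_j‖) and `β`
# (‖K_jG_jh_j‖, (2.20)) turned into statements about `greenA` on `Box d ℓ k Ms` (R9 carrier bridge, file 3/4)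

statement-level skeleton of published theorems with citation tags; proofs where landed; nothing here is a claim about the Yang–Mills mass gap

CITATION HEADER.  T. Bałaban, *Regularity and decay of lattice Green's functions*, Commun. Math. Phys. **89** (1983)
571–597, doi:10.1007/bf01214744 [Balaban1983RegularityDecay] (cell paper B4; held text
`paper:balaban1983-cmp89-regularity-decay`, journal page = PDF page + 570; pp. 572, 575–578).  Unit `lit-balaban-p17`
gen 4 (Phase-2 proof seat p17; HOME `run/shared/lean/pub/lit-balaban/`), SKELETON rows **B4.Eq2.2** (`G₀ = Σ_j
h_jG_k(□_j,Ã_j)h_j`), **B4.Eq2.10** (`R = Σ_j K_jG_k(□_j,Ã_j)h_j`), **B4.Thm@573** (per-cube inputs of the walk route).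
Imports `B4SubBoxCarrier` (file 2/4: the sub-box embedding `subEmb`, `inSub`, data identities; → `B4CubeOpReindex` file 1/4:
`pad`, `cinv`, `cutWt`, `covOp_cut_mul_padInv`, `norm_padInv_le`, letters; → `B4Lemma22Invertible`: `opA`/`greenA`
invertible for every field).

WHAT IS PRINTED (verbatim).  p. 575: *«Let us define an operator G₀ by the formula G₀ = Σ_j h_jG_k(□_j, A_j)h_j, (2.2)
where the configurations A_j are constructed in the following way : if □_j intersects the boundary of Ω, then A_j = A;
if □_j is an interior cube of Ω, then we take A_j as equal to A on the cube {x:|x − Mj| ≤ ¾M}, and changing regularly to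
a constant function in a neighbourhood of a boundary of □_j.»*; p. 576: *«(−Δ^{η,N}_{A,Ω})h_jG(□_j, A_j) =
(−Δ^{η,N}_{A_j,□_j})h_jG(□_j, A_j), (2.6)»*; (2.10)–(2.11) `R = Σ_j K_jG_k(□_j,Ã_j)h_j`; p. 578 (2.20): the factors
«‖K_{ω_i}G_k(□_{ω_i},Ã_{ω_i})h_{ω_i}‖_∞».

WHAT THIS MODULE PROVES (all in full; `Ω = Box d ℓ k Mb`, sub-box `□` of sides `Ms` at unit-lattice corner `o`,
`o_i + Ms_i ≤ Mb_i`; mesh `n = (ℓ+1)^k`; `Ã` an ARBITRARY bond field on `Ω`; running coefficient `a_kη^{d+1}` of the lineage).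
* `cubeW`/`cubeT` — the cube data of the walk route on `Ω`: links `U(κÃ_b)` between sites of `□` and transporters
  `U(Ã(Γ_{y,x}))` along [B4]'s staircase contours for sites of `□`, NULL off `□` (free data outside the plateau);
  `subW_eq`, `subT_eq` (with `B4SubBoxCarrier.subWt_eq`/`subBlk_eq`): restricted along `subEmb` they are the data of
  `Ã_□ = Ã∘subEmb` on `Box d ℓ k Ms`; **`subData_eq_b4Op`/`subData_eq_opA`** — the restricted cut data ARE
  `opA d F κ ℓ k a m2 Ms baseEmb stairContour Ã_□` (print (2.6)).
* `cdeg_ge` — off `□` every site keeps a neighbour off `□` (`d ≥ 1`, ≥ 2 fine sites per direction): `cdeg ≥ n²/2`.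
* **`cubeOp_mul_cubeGreen`** — THE HYPOTHESIS `hGj` OF THE WALK ROUTE HOLDS with `cubeGreen = pad_{subEmb}(greenA(Ã_□)) +
  cinv`, for EVERY `Ã`, `a > 0`, `m² ≥ 0`, `L ≥ 2`, `k ≥ 1` (invertibility: `B4Lemma22Invertible.opA_stair_isUnit_det`).
* **`norm_cubeGreen_le`** — the input `γ`: `‖cubeGreen‖_{ℓ∞→ℓ∞} ≤ max ‖greenA(Ã_□)‖ (2/n²)`.
* **`cube_letter_a`**, **`cube_letter_b`** — the letters `h_jG_jh_j` (2.2) and `K_jG_jh_j` (2.11) of the walk route are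
  the padded sub-box letters, the latter with `K = opK c_□ m2 (a_kη^{d+1}) q_□ (links of Ã_□) (transporters of Ã_□) h_□`
  (= `B4Eq220CommutatorField.kOp F κ n a_k m2 Ms baseEmb stairContour Ã_□ h_□` definitionally), so the input `β` is the
  sub-box's factor bound (2.20) (`B4CubeOpReindex.norm_pad`; p35's `B4Eq220FactorField`/`B4Eq220CubeField` supply it
  at regular `Ã_□` in the `supN` form, converted by `B4CubeOpReindex.linfty_opNorm_le_of_supN`).

HONEST SCOPE.  Boxes only; `Ã` arbitrary (its construction from a (1.7)-regular `A`, the plateau agreement `Ã_j = A`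
required by the walk route's `hWW′`/`hTT′`, and every analytic bound are NOT here: p35's `B4CubeFields22`/`B4Eq220CubeField`
and file 4/4).  `def`s with bodies (`subField`, `cubeW`, `cubeT`, `cubeGreen`), no `Prop` fact, no `sorry`; axioms standard.
-/

namespace Literature.MathematicalPhysics.QuantumFieldTheory.Balaban1983to89.B4CubeGreenBox

open Literature.MathematicalPhysics.QuantumFieldTheory.Balaban1983to89.B4Reflection242 (boxDom mem_boxDom nbrs mem_nbrs
  blk blk_mem_boxDom)
open Literature.MathematicalPhysics.QuantumFieldTheory.Balaban1983to89.B4GaugeCovariance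
open Literature.MathematicalPhysics.QuantumFieldTheory.Balaban1983to89.B4Commutators25to211 (mulH opK)
open Literature.MathematicalPhysics.QuantumFieldTheory.Balaban1983to89.B4Lower18Regular (e1 baseEmb stairContour)
open Literature.MathematicalPhysics.QuantumFieldTheory.Balaban1983to89.B4Lemma22ReduceZero (Box opA greenA)
open Literature.MathematicalPhysics.QuantumFieldTheory.Balaban1983to89.B4Lemma22Invertible (opA_stair_isUnit_det)
open Literature.MathematicalPhysics.QuantumFieldTheory.Balaban1983to89.B4CubeOpReindex
open Literature.MathematicalPhysics.QuantumFieldTheory.Balaban1983to89.B4SubBoxCarrier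
open scoped Matrix
open scoped Matrix.Norms.Operator

noncomputable section

variable {d : ℕ}

section Cube

variable (ℓ k : ℕ) (Mb Ms : Fin (d + 1) → ℕ) (o : Fin (d + 1) → ℕ)
variable {ι : Type} [Fintype ι] [DecidableEq ι] (F : OrthFlow ι) (κ : ℝ)

/-! ## §1. The cube data of the walk route on a box `Ω` -/

/-- the cube field seen on the sub-box's own carrier: `Ã_□(a, b) = Ã(subEmb a, subEmb b)`.
[cite: Balaban1983RegularityDecay, §2 p.575 «the configurations Ã_j», dictionary] -/
abbrev subField (ho : ∀ i, o i + Ms i ≤ Mb i) (A : ↥(Box d ℓ k Mb) → ↥(Box d ℓ k Mb) → ℝ) :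
    ↥(Box d ℓ k Ms) → ↥(Box d ℓ k Ms) → ℝ :=
  fun a b => A (subEmb ℓ k Mb Ms o ho a) (subEmb ℓ k Mb Ms o ho b)

/-- **THE CUBE LINKS** of the walk route's cube operator on the box `Ω`: the links `U(κÃ_b)` of the cube field between
sites of the cube, NULL data off the cube (free data of `B4Eq26Locality.eq26_hCube` outside the plateau).
[cite: Balaban1983RegularityDecay, (2.6) p.576, (1.2) p.572] -/
def cubeW (A : ↥(Box d ℓ k Mb) → ↥(Box d ℓ k Mb) → ℝ) : ↥(Box d ℓ k Mb) → ↥(Box d ℓ k Mb) → Matrix ι ι ℝ :=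
  fun x z => if inSub ℓ k Mb Ms o x ∧ inSub ℓ k Mb Ms o z then fieldLink F κ A x z else 0

/-- **THE CUBE TRANSPORTERS**: `U(Ã(Γ_{y,x}))` along [B4]'s staircase contours for sites of the cube, NULL off the cube.
[cite: Balaban1983RegularityDecay, (2.6) p.576, (1.4) p.572] -/
def cubeT (hn : 1 ≤ (ℓ + 1) ^ k) (A : ↥(Box d ℓ k Mb) → ↥(Box d ℓ k Mb) → ℝ) :
    ↥(boxDom Mb) → ↥(Box d ℓ k Mb) → Matrix ι ι ℝ :=
  fun y x => if inSub ℓ k Mb Ms o x then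
    contourTrans (fieldLink F κ A) (baseEmb hn Mb) (stairContour hn Mb) y x else 0

omit [Fintype ι] [DecidableEq ι] in
/-- restricted bond weights = the sub-box's bond weights. [cite: Balaban1983RegularityDecay, (1.3) p.572] -/
theorem subWt_eq (ho : ∀ i, o i + Ms i ≤ Mb i) :
    (fun b b' => boxWt ((ℓ + 1) ^ k) (fun i => (ℓ + 1) ^ k * Mb i) (subEmb ℓ k Mb Ms o ho b)
        (subEmb ℓ k Mb Ms o ho b'))
      = boxWt ((ℓ + 1) ^ k) (fun i => (ℓ + 1) ^ k * Ms i) := by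
  funext b b'
  exact boxWt_subEmb ℓ k Mb Ms o ho b b'

omit [Fintype ι] [DecidableEq ι] in
/-- restricted block weights = the sub-box's block weights. [cite: Balaban1983RegularityDecay, (1.4) p.572] -/
theorem subBlk_eq (ho : ∀ i, o i + Ms i ≤ Mb i) :
    (fun y' b => blkWt ((ℓ + 1) ^ k) Mb (fun i => (ℓ + 1) ^ k * Mb i) (subEmbY Mb Ms o ho y')
        (subEmb ℓ k Mb Ms o ho b))
      = blkWt ((ℓ + 1) ^ k) Ms (fun i => (ℓ + 1) ^ k * Ms i) := by
  funext y' b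
  exact blkWt_subEmb ℓ k Mb Ms o ho y' b

/-- restricted cube links = the links of the cube field on the sub-box. [cite: Balaban1983RegularityDecay, (1.2) p.572] -/
theorem subW_eq (ho : ∀ i, o i + Ms i ≤ Mb i) (A : ↥(Box d ℓ k Mb) → ↥(Box d ℓ k Mb) → ℝ) :
    (fun b b' => cubeW ℓ k Mb Ms o F κ A (subEmb ℓ k Mb Ms o ho b) (subEmb ℓ k Mb Ms o ho b'))
      = fieldLink F κ (subField ℓ k Mb Ms o ho A) := by
  funext b b'
  have h1 : inSub ℓ k Mb Ms o (subEmb ℓ k Mb Ms o ho b) := (inSub_iff ℓ k Mb Ms o ho _).mpr ⟨b, rfl⟩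
  have h2 : inSub ℓ k Mb Ms o (subEmb ℓ k Mb Ms o ho b') := (inSub_iff ℓ k Mb Ms o ho _).mpr ⟨b', rfl⟩
  show (if inSub ℓ k Mb Ms o (subEmb ℓ k Mb Ms o ho b) ∧ inSub ℓ k Mb Ms o (subEmb ℓ k Mb Ms o ho b')
    then fieldLink F κ A (subEmb ℓ k Mb Ms o ho b) (subEmb ℓ k Mb Ms o ho b') else 0) = _
  rw [if_pos ⟨h1, h2⟩]
  rfl

/-- restricted cube transporters = the transporters of the cube field on the sub-box along its own staircase contours.
[cite: Balaban1983RegularityDecay, (1.4) p.572] -/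
theorem subT_eq (ho : ∀ i, o i + Ms i ≤ Mb i) (hn : 1 ≤ (ℓ + 1) ^ k) (A : ↥(Box d ℓ k Mb) → ↥(Box d ℓ k Mb) → ℝ) :
    (fun y' b => cubeT ℓ k Mb Ms o F κ hn A (subEmbY Mb Ms o ho y') (subEmb ℓ k Mb Ms o ho b))
      = contourTrans (fieldLink F κ (subField ℓ k Mb Ms o ho A)) (baseEmb hn Ms) (stairContour hn Ms) := by
  funext y' b
  have h1 : inSub ℓ k Mb Ms o (subEmb ℓ k Mb Ms o ho b) := (inSub_iff ℓ k Mb Ms o ho _).mpr ⟨b, rfl⟩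
  show (if inSub ℓ k Mb Ms o (subEmb ℓ k Mb Ms o ho b) then
    contourTrans (fieldLink F κ A) (baseEmb hn Mb) (stairContour hn Mb) (subEmbY Mb Ms o ho y')
      (subEmb ℓ k Mb Ms o ho b) else 0) = _
  rw [if_pos h1]
  exact contourTrans_subEmb ℓ k Mb Ms o F κ ho hn A y' b

/-- **THE RESTRICTED CUT DATA ARE [B4]'s OPERATOR (1.6) OF THE SUB-BOX**: for every coefficient `a′` and mass `m²`,
`covOp (c∘subEmb) m2 a′ (q∘(subEmbY,subEmb)) (cubeW∘subEmb) (cubeT∘(subEmbY,subEmb)) = b4Op F κ c_□ m2 a′ q_□ baseEmb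
stairContour Ã_□` — the operator `−Δ^{η,N}_{Ã_j,□_j} + m² + a′P_k(Ã_j)` of the cube «□_j» on its own sites.
[cite: Balaban1983RegularityDecay, (2.6) p.576, (1.6) p.572] -/
theorem subData_eq_b4Op (ho : ∀ i, o i + Ms i ≤ Mb i) (hn : 1 ≤ (ℓ + 1) ^ k) (m2 a' : ℝ)
    (A : ↥(Box d ℓ k Mb) → ↥(Box d ℓ k Mb) → ℝ) :
    covOp (fun b b' => boxWt ((ℓ + 1) ^ k) (fun i => (ℓ + 1) ^ k * Mb i) (subEmb ℓ k Mb Ms o ho b)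
        (subEmb ℓ k Mb Ms o ho b')) m2 a'
      (fun y' b => blkWt ((ℓ + 1) ^ k) Mb (fun i => (ℓ + 1) ^ k * Mb i) (subEmbY Mb Ms o ho y')
        (subEmb ℓ k Mb Ms o ho b))
      (fun b b' => cubeW ℓ k Mb Ms o F κ A (subEmb ℓ k Mb Ms o ho b) (subEmb ℓ k Mb Ms o ho b'))
      (fun y' b => cubeT ℓ k Mb Ms o F κ hn A (subEmbY Mb Ms o ho y') (subEmb ℓ k Mb Ms o ho b))
      = b4Op F κ (boxWt ((ℓ + 1) ^ k) (fun i => (ℓ + 1) ^ k * Ms i)) m2 a'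
          (blkWt ((ℓ + 1) ^ k) Ms (fun i => (ℓ + 1) ^ k * Ms i)) (baseEmb hn Ms) (stairContour hn Ms)
          (subField ℓ k Mb Ms o ho A) := by
  rw [subWt_eq, subBlk_eq, subW_eq, subT_eq]
  rfl

/-- the same with the running coefficient `a_k·η^{d+1}` of the lineage: the restricted cut data are
`B4Lemma22ReduceZero.opA d F κ ℓ k a m2 Ms baseEmb stairContour Ã_□` — the operator `H_k(□_j, Ã_j)` whose inverse is
`greenA` = `G_k(□_j, Ã_j)`. [cite: Balaban1983RegularityDecay, (2.2) p.575, (1.6) p.572] -/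
theorem subData_eq_opA (ho : ∀ i, o i + Ms i ≤ Mb i) (hn : 1 ≤ (ℓ + 1) ^ k) (a m2 : ℝ)
    (A : ↥(Box d ℓ k Mb) → ↥(Box d ℓ k Mb) → ℝ) :
    covOp (fun b b' => boxWt ((ℓ + 1) ^ k) (fun i => (ℓ + 1) ^ k * Mb i) (subEmb ℓ k Mb Ms o ho b)
        (subEmb ℓ k Mb Ms o ho b')) m2
      (B1.aSeq a ((ℓ : ℝ) + 1) k * (((((ℓ + 1) ^ k : ℕ)) : ℝ) ^ (d + 1))⁻¹)
      (fun y' b => blkWt ((ℓ + 1) ^ k) Mb (fun i => (ℓ + 1) ^ k * Mb i) (subEmbY Mb Ms o ho y')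
        (subEmb ℓ k Mb Ms o ho b))
      (fun b b' => cubeW ℓ k Mb Ms o F κ A (subEmb ℓ k Mb Ms o ho b) (subEmb ℓ k Mb Ms o ho b'))
      (fun y' b => cubeT ℓ k Mb Ms o F κ hn A (subEmbY Mb Ms o ho y') (subEmb ℓ k Mb Ms o ho b))
      = opA d F κ ℓ k a m2 Ms (baseEmb hn Ms) (stairContour hn Ms) (subField ℓ k Mb Ms o ho A) :=
  subData_eq_b4Op ℓ k Mb Ms o F κ ho hn m2 _ A

omit [Fintype ι] [DecidableEq ι] in
/-- the cut bond weights are non-negative. [cite: Balaban1983RegularityDecay, (1.3) p.572] -/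
theorem cutWt_boxWt_nonneg (S : ↥(Box d ℓ k Mb) → Prop) [DecidablePred S] (z y : ↥(Box d ℓ k Mb)) :
    0 ≤ cutWt S (boxWt ((ℓ + 1) ^ k) (fun i => (ℓ + 1) ^ k * Mb i)) z y := by
  simp only [cutWt]
  split_ifs
  · unfold boxWt
    split_ifs <;> positivity
  · exact le_rfl

omit [Fintype ι] [DecidableEq ι] in
/-- **COMPLEMENT DEGREES**: off the sub-box every site keeps a lattice neighbour off the sub-box (in a direction other
than a violated one; `d ≥ 1`, at least two fine sites per direction), so its outgoing cut weight is `≥ n²/2` — the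
diagonal operator off the cube is safely invertible. [cite: Balaban1983RegularityDecay, (1.3) p.572, dictionary] -/
theorem cdeg_ge (hd : 1 ≤ d) (hMb : ∀ i, 2 ≤ (ℓ + 1) ^ k * Mb i)
    {z : ↥(Box d ℓ k Mb)} (hz : ¬ inSub ℓ k Mb Ms o z) :
    ((((ℓ + 1) ^ k : ℕ) : ℝ)) ^ 2 / 2
      ≤ cdeg (inSub ℓ k Mb Ms o) (boxWt ((ℓ + 1) ^ k) (fun i => (ℓ + 1) ^ k * Mb i)) z := by
  classical
  -- a violated coordinate `i`
  have hz' : ∃ i, ¬ ((((ℓ + 1) ^ k : ℕ) : ℤ) * (o i : ℤ) ≤ z.1 i ∧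
      z.1 i < (((ℓ + 1) ^ k : ℕ) : ℤ) * ((o i : ℤ) + Ms i)) := not_forall.mp hz
  obtain ⟨i, hi⟩ := hz'
  -- the key estimate, for any lattice neighbour of `z` inside the box with the same `i`-th coordinate
  have key : ∀ z' : ↥(Box d ℓ k Mb), z'.1 ∈ nbrs z.1 → z'.1 i = z.1 i →
      ((((ℓ + 1) ^ k : ℕ) : ℝ)) ^ 2 / 2
        ≤ cdeg (inSub ℓ k Mb Ms o) (boxWt ((ℓ + 1) ^ k) (fun i => (ℓ + 1) ^ k * Mb i)) z := by
    intro z' hnb hzi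
    have hz'out : ¬ inSub ℓ k Mb Ms o z' := fun h => by
      have := h i
      rw [hzi] at this
      exact hi this
    have hterm : cutWt (inSub ℓ k Mb Ms o) (boxWt ((ℓ + 1) ^ k) (fun i => (ℓ + 1) ^ k * Mb i)) z z'
        = ((((ℓ + 1) ^ k : ℕ) : ℝ)) ^ 2 / 2 := by
      simp only [cutWt, if_pos (iff_of_false hz hz'out)]
      unfold boxWt
      rw [if_pos hnb, mul_one]
    rw [← hterm]
    exact Finset.single_le_sum (f := fun y => cutWt (inSub ℓ k Mb Ms o)
      (boxWt ((ℓ + 1) ^ k) (fun i => (ℓ + 1) ^ k * Mb i)) z y)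
      (fun y _ => cutWt_boxWt_nonneg ℓ k Mb _ z y) (Finset.mem_univ z')
  -- another direction `j ≠ i` and a neighbour in direction `j` inside the box
  haveI : Nontrivial (Fin (d + 1)) := Fin.nontrivial_iff_two_le.mpr (by omega)
  obtain ⟨j, hji⟩ := exists_ne i
  have hzmem := (mem_boxDom.1 z.2) j
  have hMbj : (2 : ℤ) ≤ (((ℓ + 1) ^ k * Mb j : ℕ) : ℤ) := by exact_mod_cast hMb j
  by_cases hup : z.1 j + 1 < (((ℓ + 1) ^ k * Mb j : ℕ) : ℤ)
  · -- step up in direction `j`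
    have hmem : z.1 + e1 j ∈ Box d ℓ k Mb := by
      refine mem_boxDom.2 fun l => ?_
      have hl := (mem_boxDom.1 z.2) l
      by_cases hlj : l = j
      · subst hlj
        simp only [Pi.add_apply, B4Lower18Regular.e1_apply_self]
        exact ⟨by linarith [hl.1], hup⟩
      · simp only [Pi.add_apply, B4Lower18Regular.e1_apply_ne hlj, add_zero]
        exact hl
    refine key ⟨z.1 + e1 j, hmem⟩ (mem_nbrs.2 ⟨j, Or.inl rfl⟩) ?_
    simp only [Pi.add_apply, B4Lower18Regular.e1_apply_ne (Ne.symm hji), add_zero]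
  · -- step down in direction `j`
    have hdown : 1 ≤ z.1 j := by
      rw [not_lt] at hup
      linarith
    have hmem : z.1 - e1 j ∈ Box d ℓ k Mb := by
      refine mem_boxDom.2 fun l => ?_
      have hl := (mem_boxDom.1 z.2) l
      by_cases hlj : l = j
      · subst hlj
        simp only [Pi.sub_apply, B4Lower18Regular.e1_apply_self]
        exact ⟨by linarith, by linarith [hl.2]⟩
      · simp only [Pi.sub_apply, B4Lower18Regular.e1_apply_ne hlj, sub_zero]
        exact hl
    refine key ⟨z.1 - e1 j, hmem⟩ (mem_nbrs.2 ⟨j, Or.inr rfl⟩) ?_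
    simp only [Pi.sub_apply, B4Lower18Regular.e1_apply_ne (Ne.symm hji), sub_zero]

/-- **THE CUBE PROPAGATOR OF THE WALK ROUTE** on a box `Ω`: `G_j = pad_{subEmb}(G_k(□_j, Ã_j)) + cinv` with
`G_k(□_j, Ã_j) = B4Lemma22ReduceZero.greenA` on the sub-box's own carrier. [cite: Balaban1983RegularityDecay, (2.2) p.575] -/
abbrev cubeGreen (ho : ∀ i, o i + Ms i ≤ Mb i) (hn : 1 ≤ (ℓ + 1) ^ k) (a m2 : ℝ)
    (A : ↥(Box d ℓ k Mb) → ↥(Box d ℓ k Mb) → ℝ) : Matrix (↥(Box d ℓ k Mb) × ι) (↥(Box d ℓ k Mb) × ι) ℝ :=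
  pad (subEmb ℓ k Mb Ms o ho) (greenA d F κ ℓ k a m2 Ms (baseEmb hn Ms) (stairContour hn Ms)
      (subField ℓ k Mb Ms o ho A))
    + cinv (inSub ℓ k Mb Ms o) (boxWt ((ℓ + 1) ^ k) (fun i => (ℓ + 1) ^ k * Mb i)) m2

/-- **THE HYPOTHESIS `hGj` OF `B4Ineq110WalkRoute.ineq110_value` HOLDS ON A BOX, FOR EVERY CUBE FIELD `Ã`**: the
Neumann-cut cube operator (bond weights of `Ω` cut at the sub-box, cube links/transporters of `Ã`, null off the cube)
times `G_j = pad(greenA(Ã_□)) + cinv` is the identity — `a > 0`, `m² ≥ 0`, `L ≥ 2`, `k ≥ 1`, `d ≥ 1`, at least two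
fine sites per direction; NO regularity or smallness of `Ã`. [cite: Balaban1983RegularityDecay, (2.2) p.575, (2.6) p.576] -/
theorem cubeOp_mul_cubeGreen (ho : ∀ i, o i + Ms i ≤ Mb i) (hℓ : 1 ≤ ℓ) (hk : 1 ≤ k) (hn : 1 ≤ (ℓ + 1) ^ k)
    {a m2 : ℝ} (ha : 0 < a) (hm : 0 ≤ m2) (hd : 1 ≤ d) (hMb : ∀ i, 2 ≤ (ℓ + 1) ^ k * Mb i)
    (A : ↥(Box d ℓ k Mb) → ↥(Box d ℓ k Mb) → ℝ) :
    covOp (cutWt (inSub ℓ k Mb Ms o) (boxWt ((ℓ + 1) ^ k) (fun i => (ℓ + 1) ^ k * Mb i))) m2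
        (B1.aSeq a ((ℓ : ℝ) + 1) k * (((((ℓ + 1) ^ k : ℕ)) : ℝ) ^ (d + 1))⁻¹)
        (blkWt ((ℓ + 1) ^ k) Mb (fun i => (ℓ + 1) ^ k * Mb i)) (cubeW ℓ k Mb Ms o F κ A)
        (cubeT ℓ k Mb Ms o F κ hn A)
      * cubeGreen ℓ k Mb Ms o F κ ho hn a m2 A = 1 := by
  have hn0 : (0 : ℝ) < ((((ℓ + 1) ^ k : ℕ) : ℝ)) := by exact_mod_cast hn
  refine covOp_cut_mul_padInv (inSub ℓ k Mb Ms o) (subEmb_injective ℓ k Mb Ms o ho) (inSub_iff ℓ k Mb Ms o ho)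
    (subEmbY_injective Mb Ms o ho) _ m2 _ _ _ _ (fun y b h => blkWt_subEmb_ne_zero ℓ k Mb Ms o ho h)
    (fun y z z' h h' => inSub_iff_of_blkWt ℓ k Mb Ms o h h') (fun z z' hz _ => ?_) (fun y z hz _ => ?_)
    (fun z hz => ?_) ?_
  · exact if_neg (fun h : inSub ℓ k Mb Ms o z ∧ inSub ℓ k Mb Ms o z' => hz h.1)
  · exact if_neg hz
  · have := cdeg_ge ℓ k Mb Ms o hd hMb hz
    have : (0 : ℝ) < ((((ℓ + 1) ^ k : ℕ) : ℝ)) ^ 2 / 2 := by positivity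
    linarith
  · rw [subData_eq_opA]
    exact Matrix.mul_nonsing_inv _ (opA_stair_isUnit_det F κ hℓ hk hn ha hm Ms _)

/-- **THE INPUT `γ` ON A BOX**: `‖G_j‖_{ℓ∞→ℓ∞} ≤ max ‖greenA(Ã_□)‖ (2/n²)` — the sup-operator-norm of the walk route's cube
propagator is that of `G_k(□_j, Ã_j)` on the sub-box (Lemma 2.2 (2.17), `p = q = ∞`).
[cite: Balaban1983RegularityDecay, (2.17) p.578, (2.20) p.578] -/
theorem norm_cubeGreen_le (ho : ∀ i, o i + Ms i ≤ Mb i) (hn : 1 ≤ (ℓ + 1) ^ k) (a : ℝ) {m2 : ℝ} (hm : 0 ≤ m2)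
    (hd : 1 ≤ d) (hMb : ∀ i, 2 ≤ (ℓ + 1) ^ k * Mb i) (A : ↥(Box d ℓ k Mb) → ↥(Box d ℓ k Mb) → ℝ) :
    ‖cubeGreen ℓ k Mb Ms o F κ ho hn a m2 A‖
      ≤ max ‖greenA d F κ ℓ k a m2 Ms (baseEmb hn Ms) (stairContour hn Ms) (subField ℓ k Mb Ms o ho A)‖
          (2 / ((((ℓ + 1) ^ k : ℕ) : ℝ)) ^ 2) := by
  have hn0 : (0 : ℝ) < ((((ℓ + 1) ^ k : ℕ) : ℝ)) := by exact_mod_cast hn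
  have hm₀ : (0 : ℝ) < ((((ℓ + 1) ^ k : ℕ) : ℝ)) ^ 2 / 2 := by positivity
  have h := norm_padInv_le (inSub ℓ k Mb Ms o) (subEmb_injective ℓ k Mb Ms o ho) (inSub_iff ℓ k Mb Ms o ho)
    (boxWt ((ℓ + 1) ^ k) (fun i => (ℓ + 1) ^ k * Mb i)) m2 hm₀
    (fun z hz => by have := cdeg_ge ℓ k Mb Ms o hd hMb hz; linarith)
    (greenA d F κ ℓ k a m2 Ms (baseEmb hn Ms) (stairContour hn Ms) (subField ℓ k Mb Ms o ho A))
  rw [show (2 : ℝ) / ((((ℓ + 1) ^ k : ℕ) : ℝ)) ^ 2 = (((((ℓ + 1) ^ k : ℕ) : ℝ)) ^ 2 / 2)⁻¹ by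
    rw [inv_div]]
  exact h

/-- **THE LETTER `h_jG_jh_j` (2.2) ON A BOX** is the padded sub-box letter `h_□·greenA(Ã_□)·h_□` (`h_□ = h∘subEmb`), for
`supp h ⊆ □_j`; equal `ℓ∞`-operator norms. [cite: Balaban1983RegularityDecay, (2.2) p.575, (2.13) p.577] -/
theorem cube_letter_a (ho : ∀ i, o i + Ms i ≤ Mb i) (hn : 1 ≤ (ℓ + 1) ^ k) (a m2 : ℝ)
    (A : ↥(Box d ℓ k Mb) → ↥(Box d ℓ k Mb) → ℝ) (h : ↥(Box d ℓ k Mb) → ℝ)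
    (hh : ∀ z, h z ≠ 0 → inSub ℓ k Mb Ms o z) :
    mulH (ι := ι) h * cubeGreen ℓ k Mb Ms o F κ ho hn a m2 A * mulH (ι := ι) h
      = pad (subEmb ℓ k Mb Ms o ho) (mulH (ι := ι) (fun b => h (subEmb ℓ k Mb Ms o ho b))
          * greenA d F κ ℓ k a m2 Ms (baseEmb hn Ms) (stairContour hn Ms) (subField ℓ k Mb Ms o ho A)
          * mulH (ι := ι) (fun b => h (subEmb ℓ k Mb Ms o ho b))) :=
  letter_a_eq_pad (inSub ℓ k Mb Ms o) (subEmb_injective ℓ k Mb Ms o ho) (inSub_iff ℓ k Mb Ms o ho) _ m2 h hh _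

/-- **THE LETTER `K_jG_jh_j` (2.11) ON A BOX** built from the cut operator and `G_j` is the padded sub-box letter
`K_{h_□}·greenA(Ã_□)·h_□` with `K_{h_□} = opK c_□ m2 a′ q_□ (links of Ã_□) (transporters of Ã_□) h_□`
(= `B4Eq220CommutatorField.kOp F κ n a_k m2 Ms baseEmb stairContour Ã_□ h_□`, definitionally) — so **the input `β` of the
walk route is the sub-box's factor bound (2.20)** (`‖·‖` equal by `B4CubeOpReindex.norm_pad`).
[cite: Balaban1983RegularityDecay, (2.11) p.576, (2.20) p.578] -/
theorem cube_letter_b (ho : ∀ i, o i + Ms i ≤ Mb i) (hn : 1 ≤ (ℓ + 1) ^ k) (a m2 : ℝ)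
    (A : ↥(Box d ℓ k Mb) → ↥(Box d ℓ k Mb) → ℝ) (h : ↥(Box d ℓ k Mb) → ℝ)
    (hh : ∀ z, h z ≠ 0 → inSub ℓ k Mb Ms o z) :
    opK (cutWt (inSub ℓ k Mb Ms o) (boxWt ((ℓ + 1) ^ k) (fun i => (ℓ + 1) ^ k * Mb i))) m2
        (B1.aSeq a ((ℓ : ℝ) + 1) k * (((((ℓ + 1) ^ k : ℕ)) : ℝ) ^ (d + 1))⁻¹)
        (blkWt ((ℓ + 1) ^ k) Mb (fun i => (ℓ + 1) ^ k * Mb i)) (cubeW ℓ k Mb Ms o F κ A)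
        (cubeT ℓ k Mb Ms o F κ hn A) h
      * cubeGreen ℓ k Mb Ms o F κ ho hn a m2 A * mulH (ι := ι) h
      = pad (subEmb ℓ k Mb Ms o ho)
          (opK (boxWt ((ℓ + 1) ^ k) (fun i => (ℓ + 1) ^ k * Ms i)) m2
              (B1.aSeq a ((ℓ : ℝ) + 1) k * (((((ℓ + 1) ^ k : ℕ)) : ℝ) ^ (d + 1))⁻¹)
              (blkWt ((ℓ + 1) ^ k) Ms (fun i => (ℓ + 1) ^ k * Ms i))
              (fieldLink F κ (subField ℓ k Mb Ms o ho A))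
              (contourTrans (fieldLink F κ (subField ℓ k Mb Ms o ho A)) (baseEmb hn Ms) (stairContour hn Ms))
              (fun b => h (subEmb ℓ k Mb Ms o ho b))
            * greenA d F κ ℓ k a m2 Ms (baseEmb hn Ms) (stairContour hn Ms) (subField ℓ k Mb Ms o ho A)
            * mulH (ι := ι) (fun b => h (subEmb ℓ k Mb Ms o ho b))) := by
  have hmain := letter_b_eq_pad (inSub ℓ k Mb Ms o) (subEmb_injective ℓ k Mb Ms o ho) (inSub_iff ℓ k Mb Ms o ho)
    (subEmbY_injective Mb Ms o ho) (boxWt ((ℓ + 1) ^ k) (fun i => (ℓ + 1) ^ k * Mb i)) m2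
    (B1.aSeq a ((ℓ : ℝ) + 1) k * (((((ℓ + 1) ^ k : ℕ)) : ℝ) ^ (d + 1))⁻¹)
    (blkWt ((ℓ + 1) ^ k) Mb (fun i => (ℓ + 1) ^ k * Mb i)) (cubeW ℓ k Mb Ms o F κ A) (cubeT ℓ k Mb Ms o F κ hn A)
    (fun y b h => blkWt_subEmb_ne_zero ℓ k Mb Ms o ho h) (fun y z z' h h' => inSub_iff_of_blkWt ℓ k Mb Ms o h h')
    (fun z z' hz _ => if_neg (fun h : inSub ℓ k Mb Ms o z ∧ inSub ℓ k Mb Ms o z' => hz h.1))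
    (fun y z hz _ => if_neg hz) h hh
    (greenA d F κ ℓ k a m2 Ms (baseEmb hn Ms) (stairContour hn Ms) (subField ℓ k Mb Ms o ho A))
  rw [hmain, subWt_eq, subBlk_eq, subW_eq, subT_eq]

end Cube

end

end Literature.MathematicalPhysics.QuantumFieldTheory.Balaban1983to89.B4CubeGreenBox
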